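import Summits.QuantumAdvantage.QuantumAdvantage.Theses.ArithStatLadder
import Summits.QuantumAdvantage.QuantumAdvantage.Theorems.AvgFaceBeyondPrior.Negative.AvgFaceBeyondPriorNecessary

/-!
# Route `ArithStatLadder`, item `NotBPPOfAvgFace` (stmt-QuantumAdvantage-14866)

The support (glue) item of route `QuantumAdvantage/ArithStatLadder`:
`AvgFaceBeyondPrior → IqThreeNotBPP`, i.e. the average-case face
`(IQ3, U) ∉ Heur_{1/3}BPP` already gives the worst-case separation `IQ3 ∉ BPP` that the route's
deciding theorem `closes` consumes.

Reason (Bogdanov–Trevisan 2006, §2.3): `L ∈ BPP ⇒ (L, 𝒟) ∈ Heur_δBPP` for every ensemble `𝒟` and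
every `δ ≥ 0` (amplify to error `≤ 1/8`, truncate coins, lift to `(x, 1ⁿ)`; no input is bad). This is
the landed tree theorem
`Summit.QuantumAdvantage.QuantumAdvantage.Theorems.AvgFaceBeyondPrior.Negative.mem_HeurDeltaBPP_of_mem_BPP`,
packaged for IQ3 as `avgFace_imp_not_mem_BPP : AvgFaceBeyondPrior → iq3Lang ∉ BPP`
(`Theorems/AvgFaceBeyondPrior/Negative/AvgFaceBeyondPriorNecessary.lean`); `iq3Lang` is by
definition the route's literal language, so the item is that theorem re-typed against the route decl.
-/

set_option linter.dupNamespace false -- D-0017: single-problem summit ⇒ `QuantumAdvantage.QuantumAdvantage` by design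

namespace Summit.QuantumAdvantage.QuantumAdvantage.Theorems.ArithStatLadder

/-- Settles `stmt-QuantumAdvantage-14866` (route ArithStatLadder, support): the average-case face
`AvgFaceBeyondPrior` (`(IQ3, U) ∉ Heur_{1/3}BPP`) implies `IqThreeNotBPP` (`IQ3 ∉ BPP`), because
`(BPP, 𝒟) ⊆ Heur_δBPP` for every ensemble `𝒟` and every `δ ≥ 0` — the landed tree theorem
`Theorems.AvgFaceBeyondPrior.Negative.avgFace_imp_not_mem_BPP` (via `mem_HeurDeltaBPP_of_mem_BPP`),
whose language `iq3Lang` unfolds definitionally to the route's literal.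
[cite: BogdanovTrevisan2006, §2.3] [cite: AroraBarakCC2009, §18] -/
theorem NotBPPOfAvgFace_proof :
    Summit.QuantumAdvantage.QuantumAdvantage.Theses.ArithStatLadder.NotBPPOfAvgFace := by
  unfold Summit.QuantumAdvantage.QuantumAdvantage.Theses.ArithStatLadder.NotBPPOfAvgFace
  intro h
  exact Summit.QuantumAdvantage.QuantumAdvantage.Theorems.AvgFaceBeyondPrior.Negative.avgFace_imp_not_mem_BPP h

end Summit.QuantumAdvantage.QuantumAdvantage.Theorems.ArithStatLadder
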